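import Summits.BirchSwinnertonDyer.Rank1Residual.AdditivePotMult.QuadraticBaseChangeRegulatorRankOne
import Summits.BirchSwinnertonDyer.BirchSwinnertonDyer.Theorems.CMKolyvaginAtInertTwoShaCountAveragingAtTwo
import HarnessLib

/-!
# Route `CMKolyvaginAtInertTwo`, crux `CMKolyvaginExactAtInertTwo` (stmt-BirchSwinnertonDyer-24277):
# THE COUNT IDENTITY `#Ш(E/K)[2^∞] = #Ш(E/ℚ)[2^∞] · #Ш(E^{(d_K)}/ℚ)[2^∞]`, I —
# the EXACT regulator comparison `Reg(E_K/K) = 2 · Reg(E/ℚ) · Reg(E^{(c)}/ℚ)` in total rank one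
# when `E(K)` has ODD torsion

Seat `bsd-line-cmk2-p1` g15 (cell `bsd-print-cf2`); helper (`--supports stmt-BirchSwinnertonDyer-24277`).
THEOREMS ONLY: no definition, no named fact, no `sorry`; no item is closed; BSD is not proved by this.

WHY. The `p = 2` Kolyvagin–McCallum telescope of this line bounds
`#Ш(E^{ε}/ℚ)[2^∞] · #Ш(E^{−ε}/ℚ)[2^∞] ≤ 2^{2M₀}` (g14, `…PairTelescopeBoundOfInjectiveAtTwo`), while
the crux speaks of `#Ш(E_K/K)[2^∞]`. The bridge is the COUNT IDENTITY of KERNEL-STATUS §13.4, which we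
derive (files I–IV) from Milne's Weil-restriction theorem
(`Literature.….Milne1972.bsdQuotient_baseChange_quadratic_anyModel`, the route's support item
`MilneAnyModel`) by EXACT `2`-adic bookkeeping of the four factors of the Birch–Swinnerton-Dyer
quotient — regulator, torsion, Tamagawa numbers, periods. The cell `b2b-bsdres` toolkit
(`Rank1Residual/AdditivePotMult/QuadraticBaseChange*`) does this bookkeeping at every ODD prime,
where each factor is a `2`-power and hence a unit; at `p = 2` the powers must be computed exactly.

THIS FILE: the regulator. The tree's `exists_mul_regulator_baseChange_eq_of_rank_one_zero` /
`…_of_rank_zero_one` give `m · Reg(E_K) = 2 · Reg(E) · Reg(E^{(c)})` with `m ∈ {1, 4}` (`m = k²`,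
`k` the index of `E(ℚ)/tors` resp. `E^{(c)}(ℚ)/tors` in `E(K)/tors ≅ ℤ`). We prove **`m = 1` as
soon as `#E(K)_tors` is odd** (on the habitat H₂: `E(K)[2] = 0` because `ρ̄_{E,2}` is onto and
`[K:ℚ] = 2`): if `σ g_K ≡ g_K (mod T)` with `#T` odd, halve the torsion defect `t = σ g_K − g_K`
(`σ t = −t`, `t = 2s`, `σ s = −s`) — then `g_K + s` is `σ`-FIXED, hence `ℚ`-rational (Silverman
*AEC* Ex. 10.16), and still generates `E(K)/T`; so `k = ±1`. The `σ = −1` twin is symmetric.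

(The halving / averaging lemmas are in `…ShaCountAveragingAtTwo`.)
* `regulator_baseChange_eq_two_mul_of_rank_one_zero_of_odd`,
  `regulator_baseChange_eq_two_mul_of_rank_zero_one_of_odd` — `Reg(E_K) = 2·Reg(E)·Reg(E^{(c)})`
  for `K = ℚ(θ)`, `θ² = c`, in the rank distributions `(1,0)` / `(0,1)`, `#E(K)_tors` odd;
* `regulator_baseChange_quadratic_eq_two_mul_of_rank_add_eq_one_of_odd` — the same for arbitrary
  models `Wd ≅ W^{(d_K)}`, `W' ≅ W_K` in total rank one.

References: Gross–Zagier 1986 V.§2 (p. 311); Silverman *AEC* VIII.9, Ex. 10.16; Milne 1972 §1.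
-/

-- single-conjunct summit: `Summit.BirchSwinnertonDyer.BirchSwinnertonDyer.…` repeats the name by design
set_option linter.dupNamespace false
set_option autoImplicit false

noncomputable section

open scoped Classical

-- The tree's point-group lemmas over a general field `F` carry the classical `DecidableEq F` inside
-- their statements; specialised to `F = ℚ` they would meet Mathlib's `instDecidableEqRat`. Proofs that
-- handle `ℚ`-points therefore start with `letI : DecidableEq ℚ := classical` (term-local, no attribute),
-- as in `AdditivePotMult.QuadraticBaseChangeRegulatorAnyRank`.

open WeierstrassCurve Literature.NumberTheory.EllipticCurves
  Literature.NumberTheory.EllipticCurves.KrizLi2019 Literature.NumberTheory.QuadraticFields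
  Summit.BirchSwinnertonDyer.Rank1Residual.AdditivePotMult

namespace Summit.BirchSwinnertonDyer.BirchSwinnertonDyer.Theorems.ShaCountTwo


/-! ## §1 The exact regulator comparison for the raw triple `W`, `W^{(c)}`, `W_K` -/

section Raw

variable (W : WeierstrassCurve ℚ) [W.IsElliptic] (K : Type) [Field K] [NumberField K]
  (h2 : Module.finrank ℚ K = 2) {θ : K} {c : ℚ} (hθ : θ ∉ Set.range (algebraMap ℚ K))
  (hc : θ ^ 2 = algebraMap ℚ K c)

include h2 hθ hc in
/-- **Case `(1, 0)`, odd torsion: `Reg(W_K) = 2 · Reg(W) · Reg(W^{(c)})`** for `K = ℚ(θ)`,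
`θ² = c`, when `rank W(ℚ) = 1`, `rank W^{(c)}(ℚ) = 0` and `#W(K)_tors` is odd. With generators
`g_K` of `W(K)/T` and `g` of `W(ℚ)/tors`: `σ` acts as `+1` on `W(K)/T ≅ ℤ` (the image of `g` is
fixed and of infinite order); by the averaging trick some `g' ≡ g_K` is `σ`-fixed, hence
`ℚ`-rational (*AEC* Ex. 10.16), so `g ≡ ±g'` and `ĥ_K(g_K) = ĥ_K(ι g) = 2 ĥ_ℚ(g)`
(`canonicalHeight_baseChange`); `Reg(W^{(c)}) = 1`. [cite: GrossZagier1986, V.§2 (p. 311)]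
[cite: SilvermanAEC2009, Exercise 10.16 and Prop. VIII.9.1] -/
theorem regulator_baseChange_eq_two_mul_of_rank_one_zero_of_odd [(W.quadraticTwist c).IsElliptic]
    (hrQ : W.mordellWeilRank = 1) (hrc : (W.quadraticTwist c).mordellWeilRank = 0)
    (hodd : Odd (W.baseChange K).torsionOrder) :
    (W.baseChange K).regulator = 2 * W.regulator * (W.quadraticTwist c).regulator := by
  letI : DecidableEq ℚ := fun a b => Classical.propDecidable (a = b)
  haveI : (W.baseChange K).IsElliptic := isElliptic_baseChange' W K
  haveI : NeZero (2 : ℚ) := ⟨two_ne_zero⟩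
  have hrK : (W.baseChange K).mordellWeilRank = 1 := by
    rw [mordellWeilRank_baseChange_eq_add_of_sq W K h2 hθ hc, hrQ, hrc]
  obtain ⟨gK, hgK, hgenK, huniqK, hregK⟩ :=
    exists_generator_regulator_eq_of_mordellWeilRank_eq_one (W.baseChange K) hrK
  obtain ⟨g, hg, hgen, -, hreg⟩ := exists_generator_regulator_eq_of_mordellWeilRank_eq_one W hrQ
  set T := AddCommGroup.torsion (W.baseChange K).toAffine.Point with hT_def
  have hoddT : Odd (Nat.card T) := hodd
  set ι := QuadraticDescent.incl K W with hι_def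
  set σ : (W.baseChange K).toAffine.Point →+ (W.baseChange K).toAffine.Point :=
    Affine.Point.map (W' := W) (Quadratic.conj h2 hθ hc) with hσ_def
  have hσι : ∀ y : W.toAffine.Point, σ (ι y) = ι y := fun y =>
    Affine.Point.map_baseChange (W' := W) (Quadratic.conj h2 hθ hc) y
  have hσσ : ∀ x, σ (σ x) = x := fun x =>
    QuadraticDescent.conjMap_conjMap W (Quadratic.conj_conj h2 hθ hc) x
  have hσT' : ∀ x ∈ T, σ x ∈ T := fun x hx =>
    (AddCommGroup.mem_torsion _).mpr (σ.isOfFinAddOrder ((AddCommGroup.mem_torsion _).mp hx))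
  have hσT : ∀ {x y : (W.baseChange K).toAffine.Point}, x - y ∈ T → σ x - σ y ∈ T := by
    intro x y hxy
    rw [← map_sub]
    exact hσT' _ hxy
  -- coefficients
  obtain ⟨k, hk⟩ := hgenK (ι g)
  obtain ⟨e, he⟩ := hgenK (σ gK)
  have hcoef : ∀ {x : (W.baseChange K).toAffine.Point} {u v : ℤ},
      x - u • gK ∈ T → x - v • gK ∈ T → u = v := by
    intro x u v hu hv
    have hmem : (u - v) • gK ∈ T := by
      have : (u - v) • gK = (x - v • gK) - (x - u • gK) := by rw [sub_smul]; abel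
      rw [this]; exact T.sub_mem hv hu
    have := huniqK (u - v) hmem
    linarith
  have hιg : ¬ IsOfFinAddOrder (ι g) := fun hfin =>
    hg ((Affine.Point.map_injective (W' := W) _).isOfFinAddOrder_iff.mp hfin)
  have hk0 : k ≠ 0 := by
    rintro rfl
    rw [zero_smul, sub_zero] at hk
    exact hιg ((AddCommGroup.mem_torsion _).mp hk)
  -- `e = 1`: apply `σ` to `ι g ≡ k gK`
  have he1 : e = 1 := by
    have h1 : σ (ι g) - k • σ gK ∈ T := by
      have := hσT hk
      rwa [map_zsmul] at this
    rw [hσι] at h1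
    have h2' : ι g - (k * e) • gK ∈ T := by
      have hke : k • σ gK - (k * e) • gK ∈ T := by
        have : k • σ gK - (k * e) • gK = k • (σ gK - e • gK) := by rw [mul_smul, smul_sub]
        rw [this]
        exact T.zsmul_mem he k
      have : ι g - (k * e) • gK = (ι g - k • σ gK) + (k • σ gK - (k * e) • gK) := by abel
      rw [this]; exact T.add_mem h1 hke
    have hkk : k = k * e := hcoef hk h2'
    have : k * (e - 1) = 0 := by linear_combination -hkk
    rcases mul_eq_zero.mp this with h | h
    · exact absurd h hk0
    · linarith
  -- the averaging trick: a `σ`-fixed `g' ≡ gK`, which is `ℚ`-rational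
  have hdef : σ gK - gK ∈ T := by
    have := he
    rwa [he1, one_smul] at this
  obtain ⟨g', hg'T, hfix⟩ := exists_fixed_generator_of_odd σ T hσσ hσT' hoddT hdef
  obtain ⟨y, hy⟩ := AddMonoidHom.mem_range.mp (mem_range_incl_of_map_conj_eq W K h2 hθ hc g' hfix)
  obtain ⟨j, hj⟩ := hgen y
  -- `ι y ≡ (j k) gK` and `ι y = g' ≡ gK`, so `j k = 1`
  have hy1 : ι y - (j * k) • gK ∈ T := by
    have hA : ι y - j • ι g ∈ T := by
      have := ι.isOfFinAddOrder ((AddCommGroup.mem_torsion _).mp hj)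
      rw [map_sub, map_zsmul] at this
      exact (AddCommGroup.mem_torsion _).mpr this
    have hB : j • ι g - (j * k) • gK ∈ T := by
      have : j • ι g - (j * k) • gK = j • (ι g - k • gK) := by rw [mul_smul, smul_sub]
      rw [this]; exact T.zsmul_mem hk j
    have : ι y - (j * k) • gK = (ι y - j • ι g) + (j • ι g - (j * k) • gK) := by abel
    rw [this]; exact T.add_mem hA hB
  have hy2 : ι y - (1 : ℤ) • gK ∈ T := by
    rw [show ι y = g' from hy, one_smul]
    exact hg'T
  have hjk : j * k = 1 := hcoef hy1 hy2
  have hk2 : k ^ 2 = 1 := by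
    rcases Int.eq_one_or_neg_one_of_mul_eq_one' (by rw [mul_comm]; exact hjk) with ⟨h, -⟩ | ⟨h, -⟩
    · rw [h]; norm_num
    · rw [h]; norm_num
  -- heights
  have hhg : (ι g).canonicalHeight = (k : ℝ) ^ 2 * gK.canonicalHeight :=
    canonicalHeight_eq_of_sub_zsmul_mem_torsion (W.baseChange K) hk
  have hhg2 : (ι g).canonicalHeight = 2 * g.canonicalHeight := by
    have h := Affine.Point.canonicalHeight_baseChange (R := ℚ) (K := ℚ) (L := K) (W := W) g
    rw [h2] at h
    exact_mod_cast h
  have hk2R : (k : ℝ) ^ 2 = 1 := by exact_mod_cast hk2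
  rw [hregK, hreg, (W.quadraticTwist c).regulator_eq_one_of_rank_zero hrc, mul_one, ← hhg2, hhg,
    hk2R, one_mul]

include h2 hθ hc in
/-- **Case `(0, 1)`, odd torsion: `Reg(W_K) = 2 · Reg(W) · Reg(W^{(c)})`** for `K = ℚ(θ)`,
`θ² = c`, when `rank W(ℚ) = 0`, `rank W^{(c)}(ℚ) = 1` and `#W(K)_tors` is odd. Here `σ` acts as
`−1` on `W(K)/T` (a fixed generator would be `ℚ`-rational, hence torsion); by the averaging trick
some `g' ≡ g_K` is ANTI-fixed, hence of the form `Φ_K(ι_c y)` with `y ∈ W^{(c)}(ℚ)` (anti-naturality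
of the twist substitution, `hrange` as in the tree's
`exists_mul_canonicalHeight_eq_index_sq_mul_regulator_twist`), so the index of `W^{(c)}(ℚ)/tors` in
`W(K)/T` is `1` and `ĥ_K(g_K) = 2 ĥ_ℚ(g)`; `Reg(W) = 1`. [cite: GrossZagier1986, V.§2 (p. 311)]
[cite: SilvermanAEC2009, Exercise 10.16 and Prop. VIII.9.1] -/
theorem regulator_baseChange_eq_two_mul_of_rank_zero_one_of_odd [(W.quadraticTwist c).IsElliptic]
    (hrQ : W.mordellWeilRank = 0) (hrc : (W.quadraticTwist c).mordellWeilRank = 1)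
    (hodd : Odd (W.baseChange K).torsionOrder) :
    (W.baseChange K).regulator = 2 * W.regulator * (W.quadraticTwist c).regulator := by
  letI : DecidableEq ℚ := fun a b => Classical.propDecidable (a = b)
  haveI : (W.baseChange K).IsElliptic := isElliptic_baseChange' W K
  haveI : ((W.quadraticTwist c).baseChange K).IsElliptic := isElliptic_baseChange' _ K
  haveI : NeZero (2 : ℚ) := ⟨two_ne_zero⟩
  have hrK : (W.baseChange K).mordellWeilRank = 1 := by
    rw [mordellWeilRank_baseChange_eq_add_of_sq W K h2 hθ hc, hrQ, hrc]
  obtain ⟨gK, hgK, hgenK, huniqK, hregK⟩ :=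
    exists_generator_regulator_eq_of_mordellWeilRank_eq_one (W.baseChange K) hrK
  obtain ⟨g, hg, hgen, -, hreg⟩ :=
    exists_generator_regulator_eq_of_mordellWeilRank_eq_one (W.quadraticTwist c) hrc
  set T := AddCommGroup.torsion (W.baseChange K).toAffine.Point with hT_def
  have hoddT : Odd (Nat.card T) := hodd
  set Φ := twistPointEquivOver W (A := K) hθ hc with hΦ_def
  set ιd := QuadraticDescent.incl K (W.quadraticTwist c) with hιd_def
  set σ : (W.baseChange K).toAffine.Point →+ (W.baseChange K).toAffine.Point :=
    Affine.Point.map (W' := W) (Quadratic.conj h2 hθ hc) with hσ_def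
  set σd : ((W.quadraticTwist c).baseChange K).toAffine.Point →+
      ((W.quadraticTwist c).baseChange K).toAffine.Point :=
    Affine.Point.map (W' := W.quadraticTwist c) (Quadratic.conj h2 hθ hc) with hσd_def
  have hσσ : ∀ x, σ (σ x) = x := fun x =>
    QuadraticDescent.conjMap_conjMap W (Quadratic.conj_conj h2 hθ hc) x
  have hσdι : ∀ y, σd (ιd y) = ιd y := fun y =>
    Affine.Point.map_baseChange (W' := W.quadraticTwist c) (Quadratic.conj h2 hθ hc) y
  have hanti : ∀ x, σ (Φ x) = -Φ (σd x) := fun x =>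
    map_twistPointEquivOver_of_neg W hθ hc hθ hc (Quadratic.conj h2 hθ hc)
      (Quadratic.conj_gen h2 hθ hc) x
  -- anti-fixed points come from the twist
  have hrange : ∀ R : (W.baseChange K).toAffine.Point, σ R = -R → ∃ y, Φ (ιd y) = R := by
    intro R hR
    set x := Φ.symm R with hx
    have hΦx : Φ x = R := Φ.apply_symm_apply R
    have hfix : σd x = x := by
      apply Φ.injective
      have := hanti x
      rw [hΦx, hR] at this
      have h' : Φ (σd x) = R := neg_injective this.symm
      rw [h', hΦx]
    obtain ⟨y, hy⟩ := AddMonoidHom.mem_range.mp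
      (mem_range_incl_of_map_conj_eq (W.quadraticTwist c) K h2 hθ hc x hfix)
    exact ⟨y, by rw [show ιd y = x from hy, hΦx]⟩
  have hσT' : ∀ x ∈ T, σ x ∈ T := fun x hx =>
    (AddCommGroup.mem_torsion _).mpr (σ.isOfFinAddOrder ((AddCommGroup.mem_torsion _).mp hx))
  -- coefficients
  obtain ⟨k, hk⟩ := hgenK (Φ (ιd g))
  obtain ⟨e, he⟩ := hgenK (σ gK)
  have hcoef : ∀ {x : (W.baseChange K).toAffine.Point} {u v : ℤ},
      x - u • gK ∈ T → x - v • gK ∈ T → u = v := by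
    intro x u v hu hv
    have hmem : (u - v) • gK ∈ T := by
      have : (u - v) • gK = (x - v • gK) - (x - u • gK) := by rw [sub_smul]; abel
      rw [this]; exact T.sub_mem hv hu
    have := huniqK (u - v) hmem
    linarith
  have hψg : ¬ IsOfFinAddOrder (Φ (ιd g)) := fun hfin =>
    hg ((QuadraticDescent.incl_injective (K := K) (W.quadraticTwist c)).isOfFinAddOrder_iff.mp
      ((Function.Injective.isOfFinAddOrder_iff (f := Φ.toAddMonoidHom) Φ.injective).mp hfin))
  have hk0 : k ≠ 0 := by
    rintro rfl
    rw [zero_smul, sub_zero] at hk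
    exact hψg ((AddCommGroup.mem_torsion _).mp hk)
  -- `e = -1`: `gK + σ gK` is `σ`-fixed, hence `ℚ`-rational, hence torsion (`rank W(ℚ) = 0`)
  have he1 : e = -1 := by
    have hfix : σ (gK + σ gK) = gK + σ gK := by rw [map_add, hσσ, add_comm]
    obtain ⟨y0, hy0⟩ :=
      AddMonoidHom.mem_range.mp (mem_range_incl_of_map_conj_eq W K h2 hθ hc _ hfix)
    haveI : Finite W.toAffine.Point := W.mordellWeilRank_eq_zero_iff_holds.mp hrQ
    have hy0fin : IsOfFinAddOrder y0 := isOfFinAddOrder_of_finite y0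
    have htor : gK + σ gK ∈ T := by
      rw [← hy0]
      exact (AddCommGroup.mem_torsion _).mpr ((QuadraticDescent.incl K W).isOfFinAddOrder hy0fin)
    have h1e : (gK + σ gK) - (1 + e) • gK ∈ T := by
      have : (gK + σ gK) - (1 + e) • gK = σ gK - e • gK := by rw [add_smul, one_smul]; abel
      rw [this]; exact he
    have h0 : (gK + σ gK) - (0 : ℤ) • gK ∈ T := by rw [zero_smul, sub_zero]; exact htor
    have := hcoef h1e h0
    linarith
  -- the averaging trick: an anti-fixed `g' ≡ gK`, which comes from the twist
  have hdef : σ gK + gK ∈ T := by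
    have := he
    rw [he1, neg_one_zsmul, sub_neg_eq_add] at this
    exact this
  obtain ⟨g', hg'T, hantifix⟩ := exists_antifixed_generator_of_odd σ T hσσ hσT' hoddT hdef
  obtain ⟨y, hy⟩ := hrange g' hantifix
  obtain ⟨j, hj⟩ := hgen y
  have hy1 : Φ (ιd y) - (j * k) • gK ∈ T := by
    have hA : Φ (ιd y) - j • Φ (ιd g) ∈ T := by
      have := Φ.toAddMonoidHom.isOfFinAddOrder
        (ιd.isOfFinAddOrder ((AddCommGroup.mem_torsion _).mp hj))
      rw [map_sub, map_zsmul, AddEquiv.coe_toAddMonoidHom, map_sub, map_zsmul] at this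
      exact (AddCommGroup.mem_torsion _).mpr this
    have hB : j • Φ (ιd g) - (j * k) • gK ∈ T := by
      have : j • Φ (ιd g) - (j * k) • gK = j • (Φ (ιd g) - k • gK) := by rw [mul_smul, smul_sub]
      rw [this]; exact T.zsmul_mem hk j
    have : Φ (ιd y) - (j * k) • gK = (Φ (ιd y) - j • Φ (ιd g)) + (j • Φ (ιd g) - (j * k) • gK) := by
      abel
    rw [this]; exact T.add_mem hA hB
  have hy2 : Φ (ιd y) - (1 : ℤ) • gK ∈ T := by
    rw [hy, one_smul]
    exact hg'T
  have hjk : j * k = 1 := hcoef hy1 hy2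
  have hk2 : k ^ 2 = 1 := by
    rcases Int.eq_one_or_neg_one_of_mul_eq_one' (by rw [mul_comm]; exact hjk) with ⟨h, -⟩ | ⟨h, -⟩
    · rw [h]; norm_num
    · rw [h]; norm_num
  -- heights
  have hhg : (Φ (ιd g)).canonicalHeight = (k : ℝ) ^ 2 * gK.canonicalHeight :=
    canonicalHeight_eq_of_sub_zsmul_mem_torsion (W.baseChange K) hk
  have hhg2 : (Φ (ιd g)).canonicalHeight = 2 * g.canonicalHeight := by
    rw [hΦ_def, canonicalHeight_twistPointEquivOver]
    have h := Affine.Point.canonicalHeight_baseChange (R := ℚ) (K := ℚ) (L := K)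
      (W := W.quadraticTwist c) g
    rw [h2] at h
    exact_mod_cast h
  have hk2R : (k : ℝ) ^ 2 = 1 := by exact_mod_cast hk2
  rw [hregK, hreg, W.regulator_eq_one_of_rank_zero hrQ, mul_one, ← hhg2, hhg, hk2R, one_mul]

end Raw

/-! ## §2 Arbitrary models `Wd ≅ W^{(d_K)}`, `W' ≅ W_K` in total rank one -/

section Models

variable (W : WeierstrassCurve ℚ) [W.IsElliptic] (K : Type) [Field K] [NumberField K]
  (h2 : Module.finrank ℚ K = 2) (Wd : WeierstrassCurve ℚ) [Wd.IsElliptic]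
  (hWd : ∃ C : VariableChange ℚ, C • W.quadraticTwist (NumberField.discr K : ℚ) = Wd)
  (W' : WeierstrassCurve K) [W'.IsElliptic] (hW' : ∃ C : VariableChange K, C • W.baseChange K = W')

include h2 hWd hW' in
/-- **THE EXACT REGULATOR COMPARISON IN TOTAL RANK ONE WITH ODD TORSION.** `W/ℚ` elliptic, `K` a
quadratic field, `Wd` any `ℚ`-model of `W^{(d_K)}`, `W'` any `K`-model of `W_K`, with
`rank W(ℚ) + rank Wd(ℚ) = 1` and `#W'(K)_tors` odd: **`Reg(W'/K) = 2 · Reg(W/ℚ) · Reg(Wd/ℚ)`**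
(the regulator relative to `K`, Mathlib's height normalisation). Cases `(1,0)` / `(0,1)` by
`regulator_baseChange_eq_two_mul_of_rank_one_zero_of_odd` / `…_rank_zero_one_of_odd`; models by
`regulator_variableChange_holds`, `mordellWeilRank_variableChange_holds`,
`torsionOrder_variableChange_holds`, `W^{(d_K)} ≅ W^{(c)}` (`d_K = c q²`).
[cite: GrossZagier1986, V.§2 (p. 311)] [cite: SilvermanAEC2009, Exercise 10.16] -/
theorem regulator_baseChange_quadratic_eq_two_mul_of_rank_add_eq_one_of_odd
    (hr : W.mordellWeilRank + Wd.mordellWeilRank = 1) (hodd : Odd W'.torsionOrder) :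
    W'.regulator = 2 * W.regulator * Wd.regulator := by
  obtain ⟨θ, c, hθ, hc⟩ := Quadratic.exists_sq_eq_algebraMap (F := ℚ) (K := K) h2
  obtain ⟨q, hq, hd⟩ := NumberField.exists_discr_eq_mul_sq h2 hθ hc
  obtain ⟨C₁, hC₁⟩ := W.exists_variableChange_quadraticTwist_mul_sq c q hq
  rw [← hd] at hC₁
  obtain ⟨Cd, hCd⟩ := hWd
  obtain ⟨C', hC'⟩ := hW'
  subst hCd hC'
  have hc0 : c ≠ 0 := by
    rintro rfl
    apply Quadratic.ne_zero_of_not_mem_range hθ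
    have : θ ^ 2 = 0 := by rw [hc, map_zero]
    exact pow_eq_zero_iff (n := 2) (by norm_num) |>.mp this
  haveI : (W.quadraticTwist c).IsElliptic := W.isElliptic_quadraticTwist hc0
  have hD : (NumberField.discr K : ℚ) ≠ 0 := by exact_mod_cast NumberField.discr_ne_zero K
  haveI : (W.quadraticTwist (NumberField.discr K : ℚ)).IsElliptic := W.isElliptic_quadraticTwist hD
  haveI : (W.baseChange K).IsElliptic := isElliptic_baseChange' W K
  have hregd : (Cd • W.quadraticTwist (NumberField.discr K : ℚ)).regulator =
      (W.quadraticTwist c).regulator := by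
    rw [regulator_variableChange_holds, ← hC₁, regulator_variableChange_holds]
  have hrkd : (Cd • W.quadraticTwist (NumberField.discr K : ℚ)).mordellWeilRank =
      (W.quadraticTwist c).mordellWeilRank := by
    rw [mordellWeilRank_variableChange_holds, ← hC₁, mordellWeilRank_variableChange_holds]
  have hreg' : (C' • W.baseChange K).regulator = (W.baseChange K).regulator :=
    regulator_variableChange_holds _ C'
  have htor' : (C' • W.baseChange K).torsionOrder = (W.baseChange K).torsionOrder :=
    torsionOrder_variableChange_holds _ C'
  rw [hregd, hreg']
  rw [hrkd] at hr
  rw [htor'] at hodd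
  rcases Nat.eq_zero_or_pos W.mordellWeilRank with h0 | hpos
  · rw [h0, zero_add] at hr
    exact regulator_baseChange_eq_two_mul_of_rank_zero_one_of_odd W K h2 hθ hc h0 hr hodd
  · have hle : W.mordellWeilRank ≤ 1 := hr ▸ Nat.le_add_right _ _
    have h1 : W.mordellWeilRank = 1 := le_antisymm hle hpos
    have h0 : (W.quadraticTwist c).mordellWeilRank = 0 := by
      rw [h1] at hr
      exact Nat.add_left_cancel (hr.trans (add_zero 1).symm)
    exact regulator_baseChange_eq_two_mul_of_rank_one_zero_of_odd W K h2 hθ hc h1 h0 hodd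

end Models

end Summit.BirchSwinnertonDyer.BirchSwinnertonDyer.Theorems.ShaCountTwo

end
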